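import Summits.FinalStateConjecture.FinalStateConjecture.Theses.LaminatedThreshold
import HarnessLib

/-!
# `TameExitsLocalise` (crux B of route `LaminatedThreshold`, stmt-FinalStateConjecture-16894) — negative lemma:
# the crux is refuted by any LOCALLY INCURABLE admissible datum with a TAME GOOD EXIT

The crux `Theses.LaminatedThreshold.TameExitsLocalise` reads: for every `X` and every admissible exceptional datum `d⋆`, a
tame, immersed, injective, admissible one-parameter family through `d⋆` all of whose members `c ≠ 0` are good yields a
jointly smooth, immersed, injective, admissible family through `d⋆` which AGREES WITH `d⋆` OFF ONE COMPACT SET and is good on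
a punctured window. This file records, kernel-checked and BY NAME, the negation frame of the crux strategist's census
(`Cruxes/TameExitsLocalise/STRATEGY-CENSUS.md` §Negation; `StrategistSketch.lean` §2, there over folded vocabulary in a
non-importable `Cruxes/` module): if SOME admissible datum is

* LOCALLY INCURABLE — every admissible datum agreeing with it outside some compact set is exceptional (not good) —, and
* TAMELY CURABLE — it is the base `F 0` of a tame, immersed, injective, admissible family with all members `c ≠ 0` good —,

then the crux is false (`tameExitsLocalise_false_of_existsIncurableTameExit`): at that datum the crux's hypotheses hold
(taking `C = ∅` shows the datum itself is exceptional) while every member of every compactly supported admissible family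
through it is exceptional, in particular the member at `c = (ε/2)·e₀` of the would-be local exit. The hypothesis is packaged
as the construction target `ExistsIncurableTameExit`; it is NOT constructible in the tree today. Intended witness (census
§Negation, design A): on `X = ℝ³` the maximal, conformally flat vacuum datum `d_GO` carrying a locally finite train of far,
high-frequency, Dafermos–Rodnianski-admissible incoming gravitational-wave shells whose foci (curvature `≍ 1` at times
`tₙ = 0.9 rₙ → ∞`, dense directions) lie outside the domain of influence of every compact set — locally incurable by
far-field focal analysis plus a slab-rigidity lemma, tamely curable iff "Minkowski + finitely many admissible
geometric-optics shells + a small compactly supported TT wiggle settles (`N = 0`)", a LARGE-data global statement which is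
physically immediate and print-open (the members are large in every weighted `H^s`, `s ≥ 3`; Christodoulou–Klainerman /
Bieri / Lindblad–Rodnianski smallness fails; nearest prints: Touati, arXiv:2206.12318 (local-in-time geometric optics for
vacuum), Huneau–Luk, Duke Math. J. 167 (2018) (U(1) symmetry)). The lemma makes precise WHICH construction refutes the crux
as typed and why every proof line for it (birth S2 `GoodnessTailRobust`; k2 `RectangleBitAtExits`, `NakedTransferAtExits`)
must fail at such a datum; the route-level repairs are recorded in `Cruxes/TameExitsLocalise/RepairSketch.lean`
(`closesKerrEnded`) and landed as `Theorems.LaminatedThreshold.TailGluing.not_finalStateConjecture_of_nakedLamination`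
(the re-cut without crux B). No cited facts; no new structures; pure logic over the route decl.
-/

set_option linter.dupNamespace false

noncomputable section

namespace Summit.FinalStateConjecture.FinalStateConjecture.Theorems.TameExitsLocalise.Negative

open scoped Manifold
open Set

/-- **Construction target `ExistsIncurableTameExit` (the `H` of the negative lemma below).** There are a one-ended data
carrier `X` and an ADMISSIBLE vacuum datum `d⋆` on it which is (1) LOCALLY INCURABLE: for every compact `C ⊆ X`, every
admissible datum `d'` with `(h', k') = (h⋆, k⋆)` pointwise off `C` is exceptional — it is false that an MGHD exists and every
MGHD has complete sojourn-`𝓘⁺` and a sub-extremal, ray-closed, exhaustive, future-oriented two-Kerr-chart final state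
decomposition (verbatim the summit's per-datum property) —, and (2) TAMELY CURABLE: there are an end `e` and a family
`F : ℝ¹ → data` which is tame on `e` (`IsTameDataFamily e 1 F`), immersed at `0`, has `F 0 = d⋆`, is injective, has
admissible members, and has every member `c ≠ 0` good (verbatim the crux's tame-exit hypothesis). Intended witness: the
geometric-optics shell-train datum `d_GO` of the crux strategist's census with its receding tame smoothing family; (1) is
far-field focal analysis + a slab-rigidity lemma, (2) is the large-data statement "Minkowski + finitely many admissible
geometric-optics shells settles" (print-open). If `H` is refuted the lemma below is vacuous; the crux stays research-open
either way (its positive content is large-data (multi-)Kerr stability + locality of exceptionality). [folklore] -/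
@[conjecture] def ExistsIncurableTameExit : Prop :=
  ∃ (X : Type) (_ : TopologicalSpace X) (_ : ChartedSpace Literature.Geometry.Lorentzian.E3 X) (_ : IsManifold (𝓡 3) ((⊤ : ℕ∞) : WithTop ℕ∞) X) (_ : T2Space X) (_ : SecondCountableTopology X) (_ : ConnectedSpace X) (dstar : Literature.Geometry.Lorentzian.InitialDataSet (𝓡 3) X), dstar ∈ Literature.Geometry.Lorentzian.admissibleVacuumData X ∧ (∀ C : Set X, IsCompact C → ∀ d' ∈ Literature.Geometry.Lorentzian.admissibleVacuumData X, (∀ x ∉ C, d'.h.inner x = dstar.h.inner x ∧ d'.k x = dstar.k x) → ¬ ((∃ 𝒟 : Literature.Geometry.Lorentzian.VacuumCauchyDevelopment d', 𝒟.IsMaximal) ∧ ∀ 𝒟 : Literature.Geometry.Lorentzian.VacuumCauchyDevelopment d', 𝒟.IsMaximal → Summit.FinalStateConjecture.HasCompleteNullInfinity 𝒟.toCauchyDevelopment ∧ ∃ (O : Set 𝒟.carrier) (d : Literature.Geometry.Lorentzian.FinalStateDecomposition 𝒟.toSpacetime O 2), (∀ i, Literature.Geometry.Lorentzian.Kerr.IsSubextremal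 (d.mass i) (d.spin i)) ∧ O = Summit.FinalStateConjecture.exteriorOf 𝒟.toCauchyDevelopment d.charted ∧ Summit.FinalStateConjecture.RaysStayInClosure 𝒟.toCauchyDevelopment O ∧ Summit.FinalStateConjecture.HasExhaustiveCharts d ∧ Summit.FinalStateConjecture.IsFutureOriented d)) ∧ ∃ (e : Literature.Geometry.Lorentzian.AFEnd X) (F : EuclideanSpace ℝ (Fin 1) → Literature.Geometry.Lorentzian.InitialDataSet (𝓡 3) X), Literature.Geometry.Lorentzian.InitialDataSet.IsTameDataFamily e 1 F ∧ Literature.Geometry.Lorentzian.InitialDataSet.IsImmersedAtZero 1 F ∧ F 0 = dstar ∧ Function.Injective F ∧ (∀ c, F c ∈ Literature.Geometry.Lorentzian.admissibleVacuumData X) ∧ ∀ c, c ≠ 0 → ((∃ 𝒟 : Literature.Geometry.Lorentzian.VacuumCauchyDevelopment (F c), 𝒟.IsMaximal) ∧ ∀ 𝒟 : Literature.Geometry.Lorentzian.VacuumCauchyDevelopment (F c), 𝒟.IsMaximal → Summit.FinalStateConjecture.HasCompleteNullInfinity 𝒟.toCauchyDevelopment ∧ ∃ (O : Set 𝒟.carrier)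 (d : Literature.Geometry.Lorentzian.FinalStateDecomposition 𝒟.toSpacetime O 2), (∀ i, Literature.Geometry.Lorentzian.Kerr.IsSubextremal (d.mass i) (d.spin i)) ∧ O = Summit.FinalStateConjecture.exteriorOf 𝒟.toCauchyDevelopment d.charted ∧ Summit.FinalStateConjecture.RaysStayInClosure 𝒟.toCauchyDevelopment O ∧ Summit.FinalStateConjecture.HasExhaustiveCharts d ∧ Summit.FinalStateConjecture.IsFutureOriented d)

/-- **Negative lemma: a locally incurable admissible datum with a tame good exit refutes `TameExitsLocalise`.** At the
witness datum the crux's hypotheses hold (`C = ∅`, `d' = d⋆` gives exceptionality of `d⋆`; the tame good exit is given),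
so the crux yields a compactly supported admissible family `F'` through `d⋆`, equal to `d⋆` off a compact `C`, good for
`0 < ‖c‖ < ε`; but its member at `c = (ε/2)·e₀ ≠ 0` is admissible and agrees with `d⋆` off `C`, hence exceptional by local
incurability — contradiction. The item stays open: `ExistsIncurableTameExit` is a construction target, not a theorem. -/
theorem tameExitsLocalise_false_of_existsIncurableTameExit :
    ExistsIncurableTameExit → ¬ Summit.FinalStateConjecture.FinalStateConjecture.Theses.LaminatedThreshold.TameExitsLocalise := by
  rintro ⟨X, i₁, i₂, i₃, i₄, i₅, i₆, dstar, hd, hinc, hexit⟩ hB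
  have hbad := hinc ∅ isCompact_empty dstar hd fun _ _ ↦ ⟨rfl, rfl⟩
  obtain ⟨F', -, -, -, -, hadm, ⟨C, hC, hagree⟩, ε, hε, hgood⟩ := hB X dstar hd hbad hexit
  set v : EuclideanSpace ℝ (Fin 1) := EuclideanSpace.single (0 : Fin 1) (1 : ℝ) with hv
  have hnv : ‖v‖ = 1 := by simp [hv]
  set c : EuclideanSpace ℝ (Fin 1) := (ε / 2) • v with hc
  have hnorm : ‖c‖ = ε / 2 := by
    rw [hc, norm_smul, hnv, mul_one, Real.norm_eq_abs, abs_of_pos (by positivity)]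
  have hc0 : c ≠ 0 := by
    intro h0
    rw [h0, norm_zero] at hnorm
    linarith
  have hcε : ‖c‖ < ε := by rw [hnorm]; linarith
  exact hinc C hC (F' c) (hadm c) (hagree c) (hgood c hc0 hcε)

/-- Contrapositive bookkeeping: the crux forbids locally incurable admissible data with tame good exits (so a proof of the
crux as typed must in particular exclude the census's shell-train datum from the admissible class or deny that its tame
smoothings are good). -/
theorem not_existsIncurableTameExit_of_tameExitsLocalise
    (hB : Summit.FinalStateConjecture.FinalStateConjecture.Theses.LaminatedThreshold.TameExitsLocalise) :
    ¬ ExistsIncurableTameExit :=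
  fun h ↦ tameExitsLocalise_false_of_existsIncurableTameExit h hB

end Summit.FinalStateConjecture.FinalStateConjecture.Theorems.TameExitsLocalise.Negative

end
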